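import Summits.KontsevichZagierPeriods.KontsevichZagierPeriods.Theorems.LinRedNormalFormArrangementNormalFormSeparateThreeHHKSplit

/-!
# The ray theorems on a nested thin sector

(Line `janus-bands`, crux `ArrangementNormalForm`, stub `stub_separateHigh`, part `HHKRay` of
the wall-invariant termwise-split lemma `separateThree_hHk` in base dimension `3` with fibres.)
Abstract analytic core on a nested thin sector in blown-up coordinates `(t, v, u)`: the weight `W`
is jointly measurable, almost decreasing towards the corner at ratio `4` on the big box
(constant `K`), with logarithmic costs (`Kn`, `C`) in the FREE variables.
* `ray_order3` (type (I): `t` graded, `v, u` free; registered as `separateThreeHHK_ray`): if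
  `∑ₐ Φₐ(v, u) t^a` is absolutely `W`-integrable on the big box and the row `Φ_{a₀}` is bounded
  below on the dyadic box `[2δ, 4δ] × [2ε, 4ε]`, then `t^{a₀} · W` is integrable over
  `(0, δt) × (0, 4δ) × (0, 4ε)`; `piece_order_lt_top` then bounds every `O(t^{a₀})` function;
* `ray_bigraded3` (type (III), slope-`r` frames: `(t, v)` graded, `u` free), with
  `pieces_bigraded_lt_top` for the pieces;
* `ray_trigraded3` (type (III), monomial frames): pieces with pairwise disjoint monomial supports
  are absolutely integrable as soon as their sum is (`SepHHK.monoSplit₃`).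
-/

noncomputable section

open Set MeasureTheory
open scoped ENNReal

namespace Summit.KontsevichZagierPeriods.ArrangementNormalForm.JanusBands

namespace SepHHK

open SepTwo

variable {D : ℕ} (W : ℝ → ℝ → ℝ → ℝ≥0∞)

/-! ### Type (I): the order output -/

/-- **Ray theorem of type (I).** See the module docstring. -/
theorem ray_order3 (hW : Measurable fun p : ℝ × ℝ × ℝ => W p.1 p.2.1 p.2.2)
    (Φ : Fin (D + 1) → ℝ → ℝ → ℝ) (hΦm : ∀ a, Measurable fun p : ℝ × ℝ => Φ a p.1 p.2)
    (K : ℝ≥0∞) (hK : K ≠ ∞) (Kn : ℕ) (C : ℝ≥0∞) (hC : C ≠ ∞) {δt δ ε : ℝ}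
    (hδ : 0 < δ) (hε : 0 < ε)
    (hmono : ∀ v ∈ Ioo (0 : ℝ) (4 * δ), ∀ u ∈ Ioo (0 : ℝ) (4 * ε), ∀ t t', 0 < t → t ≤ t' →
      t' ≤ 4 * t → t' < 4 * δt → W t v u ≤ K * W t' v u)
    (hvlog : ∀ t ∈ Ioo (0 : ℝ) δt, ∀ u ∈ Ioo (0 : ℝ) (4 * ε), ∀ v v', 0 < v → v ≤ v' →
      v' < 4 * δ → W t v u ≤ C * ENNReal.ofReal ((1 + Real.log (v' / v)) ^ Kn) * W t v' u)
    (hulog : ∀ t ∈ Ioo (0 : ℝ) δt, ∀ v ∈ Ioo (2 * δ) (4 * δ), ∀ u u', 0 < u → u ≤ u' →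
      u' < 4 * ε → W t v u ≤ C * ENNReal.ofReal ((1 + Real.log (u' / u)) ^ Kn) * W t v u')
    (a₀ : Fin (D + 1)) {h : ℝ} (hh : 0 < h)
    (hlow : ∀ v ∈ Icc (2 * δ) (4 * δ), ∀ u ∈ Icc (2 * ε) (4 * ε), h ≤ |Φ a₀ v u|)
    (hfin : ∫⁻ t in Ioo 0 (4 * δt), ∫⁻ v in Ioo 0 (4 * δ), ∫⁻ u in Ioo 0 (4 * ε),
      ENNReal.ofReal |pev (fun a => Φ a v u) t| * W t v u < ∞) :
    ∫⁻ t in Ioo 0 δt, ∫⁻ v in Ioo 0 (4 * δ), ∫⁻ u in Ioo 0 (4 * ε),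
      ENNReal.ofReal (t ^ (a₀ : ℕ)) * W t v u < ∞ := by
  have h1 := split_t_lt_top W hW (fun v u a => Φ a v u) hΦm K hK δt measurableSet_Ioo
    measurableSet_Ioo hmono hfin a₀
  have h2 : ∫⁻ t in Ioo 0 δt, ∫⁻ v in Ioo (2 * δ) (4 * δ), ∫⁻ u in Ioo (2 * ε) (4 * ε),
      ENNReal.ofReal (t ^ (a₀ : ℕ)) * W t v u < ∞ :=
    lower_box_lt_top W measurableSet_Ioo measurableSet_Ioo measurableSet_Ioo
      (Ioo_subset_Ioo (by linarith) le_rfl) (Ioo_subset_Ioo (by linarith) le_rfl)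
      (fun v u => Φ a₀ v u) (fun t => t ^ (a₀ : ℕ)) (fun t ht => pow_nonneg ht.1.le _) hh
      (fun v hv u hu => hlow v (Ioo_subset_Icc_self hv) u (Ioo_subset_Icc_self hu)) h1
  -- sweep in `u`
  have h3 : ∫⁻ t in Ioo 0 δt, ∫⁻ v in Ioo (2 * δ) (4 * δ), ∫⁻ u in Ioo 0 (4 * ε),
      ENNReal.ofReal (t ^ (a₀ : ℕ)) * W t v u < ∞ := by
    have h2' : ∫⁻ t in Ioo 0 δt, ∫⁻ v in Ioo (2 * δ) (4 * δ), ∫⁻ u in Ioo (4 * ε / 2) (4 * ε),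
        ENNReal.ofReal (t ^ (a₀ : ℕ)) * W t v u < ∞ := by
      rwa [show 4 * ε / 2 = 2 * ε by ring]
    exact sweep_u_lt_top W hW Kn C hC (by linarith) measurableSet_Ioo measurableSet_Ioo hulog
      (fun t _ => t ^ (a₀ : ℕ)) h2'
  have h3' : ∫⁻ t in Ioo 0 δt, ∫⁻ v in Ioo (4 * δ / 2) (4 * δ), ∫⁻ u in Ioo 0 (4 * ε),
      ENNReal.ofReal (t ^ (a₀ : ℕ)) * W t v u < ∞ := by rwa [show 4 * δ / 2 = 2 * δ by ring]
  exact sweep_v_lt_top W hW Kn C hC (by linarith) measurableSet_Ioo measurableSet_Ioo hvlog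
    (fun t _ => t ^ (a₀ : ℕ)) (measurable_fst.pow_const _) h3'

/-- A polynomial whose low coefficients vanish is `O(t^{a₀})` on `[0, 1]`. -/
theorem abs_pev_le_of_low_zero (γ : Fin (D + 1) → ℝ) (a₀ : ℕ) {B : ℝ}
    (hlow : ∀ a : Fin (D + 1), (a : ℕ) < a₀ → γ a = 0) (hB : ∀ a, |γ a| ≤ B) {t : ℝ}
    (ht0 : 0 ≤ t) (ht1 : t ≤ 1) : |pev γ t| ≤ (D + 1) * B * t ^ a₀ := by
  unfold pev
  have hB0 : 0 ≤ B := (abs_nonneg _).trans (hB 0)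
  calc |∑ a : Fin (D + 1), γ a * t ^ (a : ℕ)| ≤ ∑ a : Fin (D + 1), |γ a * t ^ (a : ℕ)| :=
        Finset.abs_sum_le_sum_abs _ _
    _ ≤ ∑ _a : Fin (D + 1), B * t ^ a₀ := by
        refine Finset.sum_le_sum fun a _ => ?_
        rw [abs_mul, abs_of_nonneg (pow_nonneg ht0 _)]
        by_cases ha : (a : ℕ) < a₀
        · rw [hlow a ha, abs_zero, zero_mul]; positivity
        · exact mul_le_mul (hB a) (pow_le_pow_of_le_one ht0 ht1 (not_lt.1 ha)) (pow_nonneg ht0 _) hB0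
    _ = (D + 1) * B * t ^ a₀ := by
        rw [Finset.sum_const, Finset.card_univ, Fintype.card_fin, nsmul_eq_mul]
        push_cast; ring

/-- **Domination of a piece of order `a₀`.** -/
theorem piece_order_lt_top {A B C : Set ℝ} (hA : MeasurableSet A) (hB : MeasurableSet B)
    (hC : MeasurableSet C) (G : ℝ → ℝ → ℝ → ℝ) (a₀ : ℕ) {M : ℝ} (hM : 0 ≤ M)
    (hG : ∀ t ∈ A, ∀ v ∈ B, ∀ u ∈ C, |G t v u| ≤ M * t ^ a₀)
    (hfin : ∫⁻ t in A, ∫⁻ v in B, ∫⁻ u in C, ENNReal.ofReal (t ^ a₀) * W t v u < ∞) :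
    ∫⁻ t in A, ∫⁻ v in B, ∫⁻ u in C, ENNReal.ofReal |G t v u| * W t v u < ∞ := by
  calc ∫⁻ t in A, ∫⁻ v in B, ∫⁻ u in C, ENNReal.ofReal |G t v u| * W t v u
      ≤ ∫⁻ t in A, ∫⁻ v in B, ∫⁻ u in C, ENNReal.ofReal M * (ENNReal.ofReal (t ^ a₀) * W t v u) := by
        refine iter_mono hA hB hC fun t ht v hv u hu => ?_
        rw [← mul_assoc, ← ENNReal.ofReal_mul hM]
        exact mul_le_mul_left (ENNReal.ofReal_le_ofReal (hG t ht v hv u hu)) _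
    _ = ENNReal.ofReal M * ∫⁻ t in A, ∫⁻ v in B, ∫⁻ u in C, ENNReal.ofReal (t ^ a₀) * W t v u := by
        rw [← lintegral_const_mul' _ _ ENNReal.ofReal_ne_top]
        refine lintegral_congr fun t => ?_
        rw [← lintegral_const_mul' _ _ ENNReal.ofReal_ne_top]
        refine lintegral_congr fun v => ?_
        rw [← lintegral_const_mul' _ _ ENNReal.ofReal_ne_top]
    _ < ∞ := ENNReal.mul_lt_top ENNReal.ofReal_lt_top hfin

/-! ### Type (III), slope-`r` frames: the bigraded output -/

/-- A lower bound on a sub-range of the last variable. -/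
theorem lower_last_lt_top {A B C C₂ : Set ℝ} (hA : MeasurableSet A) (hB : MeasurableSet B)
    (hC₂ : MeasurableSet C₂) (hCC : C₂ ⊆ C) (H : ℝ → ℝ) (F : ℝ → ℝ → ℝ)
    (hF : ∀ t ∈ A, ∀ v ∈ B, 0 ≤ F t v) {h : ℝ} (hh : 0 < h) (hle : ∀ u ∈ C₂, h ≤ |H u|)
    (hfin : ∫⁻ t in A, ∫⁻ v in B, ∫⁻ u in C, ENNReal.ofReal (|H u| * F t v) * W t v u < ∞) :
    ∫⁻ t in A, ∫⁻ v in B, ∫⁻ u in C₂, ENNReal.ofReal (F t v) * W t v u < ∞ := by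
  have hpt : ∀ t ∈ A, ∀ v ∈ B, ∀ u ∈ C₂, ENNReal.ofReal (F t v) * W t v u ≤
      ENNReal.ofReal h⁻¹ * (ENNReal.ofReal (|H u| * F t v) * W t v u) := by
    intro t ht v hv u hu
    rw [← mul_assoc, ← ENNReal.ofReal_mul (inv_nonneg.2 hh.le)]
    refine mul_le_mul_left (ENNReal.ofReal_le_ofReal ?_) _
    have h1 : 1 ≤ h⁻¹ * |H u| := by
      rw [le_inv_mul_iff₀ hh, mul_one]; exact hle u hu
    calc F t v = 1 * F t v := (one_mul _).symm
      _ ≤ h⁻¹ * |H u| * F t v := mul_le_mul_of_nonneg_right h1 (hF t ht v hv)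
      _ = h⁻¹ * (|H u| * F t v) := by ring
  calc ∫⁻ t in A, ∫⁻ v in B, ∫⁻ u in C₂, ENNReal.ofReal (F t v) * W t v u
      ≤ ∫⁻ t in A, ∫⁻ v in B, ∫⁻ u in C₂,
          ENNReal.ofReal h⁻¹ * (ENNReal.ofReal (|H u| * F t v) * W t v u) := iter_mono hA hB hC₂ hpt
    _ = ENNReal.ofReal h⁻¹ * ∫⁻ t in A, ∫⁻ v in B, ∫⁻ u in C₂,
          ENNReal.ofReal (|H u| * F t v) * W t v u := by
        rw [← lintegral_const_mul' _ _ ENNReal.ofReal_ne_top]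
        refine lintegral_congr fun t => ?_
        rw [← lintegral_const_mul' _ _ ENNReal.ofReal_ne_top]
        refine lintegral_congr fun v => ?_
        rw [← lintegral_const_mul' _ _ ENNReal.ofReal_ne_top]
    _ ≤ ENNReal.ofReal h⁻¹ * ∫⁻ t in A, ∫⁻ v in B, ∫⁻ u in C,
          ENNReal.ofReal (|H u| * F t v) * W t v u :=
        mul_le_mul_right (lintegral_mono fun t => lintegral_mono fun v => lintegral_mono_set hCC) _
    _ < ∞ := ENNReal.mul_lt_top ENNReal.ofReal_lt_top hfin

/-- **Ray theorem of type (III), slope-`r` frames.** See the module docstring. -/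
theorem ray_bigraded3 (hW : Measurable fun p : ℝ × ℝ × ℝ => W p.1 p.2.1 p.2.2)
    (H : Fin (D + 1) → Fin (D + 1) → ℝ → ℝ) (hHm : ∀ a b, Measurable (H a b))
    (K : ℝ≥0∞) (hK : K ≠ ∞) (Kn : ℕ) (C : ℝ≥0∞) (hC : C ≠ ∞) {δt δ ε : ℝ} (hε : 0 < ε)
    (hmonot : ∀ v ∈ Ioo (0 : ℝ) (4 * δ), ∀ u ∈ Ioo (0 : ℝ) (4 * ε), ∀ t t', 0 < t → t ≤ t' →
      t' ≤ 4 * t → t' < 4 * δt → W t v u ≤ K * W t' v u)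
    (hmonov : ∀ t ∈ Ioo (0 : ℝ) δt, ∀ u ∈ Ioo (0 : ℝ) (4 * ε), ∀ v v', 0 < v → v ≤ v' →
      v' ≤ 4 * v → v' < 4 * δ → W t v u ≤ K * W t v' u)
    (hulog : ∀ t ∈ Ioo (0 : ℝ) δt, ∀ v ∈ Ioo (0 : ℝ) δ, ∀ u u', 0 < u → u ≤ u' →
      u' < 4 * ε → W t v u ≤ C * ENNReal.ofReal ((1 + Real.log (u' / u)) ^ Kn) * W t v u')
    (hfin : ∫⁻ t in Ioo 0 (4 * δt), ∫⁻ v in Ioo 0 (4 * δ), ∫⁻ u in Ioo 0 (4 * ε),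
      ENNReal.ofReal |∑ a : Fin (D + 1), ∑ b : Fin (D + 1), H a b u * t ^ (a : ℕ) * v ^ (b : ℕ)| *
        W t v u < ∞)
    (a b : Fin (D + 1)) {h : ℝ} (hh : 0 < h) (hle : ∀ u ∈ Icc (2 * ε) (4 * ε), h ≤ |H a b u|) :
    ∫⁻ t in Ioo 0 δt, ∫⁻ v in Ioo 0 δ, ∫⁻ u in Ioo 0 (4 * ε),
      ENNReal.ofReal (t ^ (a : ℕ) * v ^ (b : ℕ)) * W t v u < ∞ := by
  -- split in `t` with coefficients `∑_b H a b u v^b`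
  set ct : ℝ → ℝ → Fin (D + 1) → ℝ := fun v u a => ∑ b : Fin (D + 1), H a b u * v ^ (b : ℕ) with hct
  have hctm : ∀ a, Measurable fun p : ℝ × ℝ => ct p.1 p.2 a := fun a => by
    simp only [hct]
    exact Finset.measurable_sum _ fun b _ => ((hHm a b).comp measurable_snd).mul
      (measurable_fst.pow_const _)
  have hfin' : ∫⁻ t in Ioo 0 (4 * δt), ∫⁻ v in Ioo 0 (4 * δ), ∫⁻ u in Ioo 0 (4 * ε),
      ENNReal.ofReal |pev (ct v u) t| * W t v u < ∞ := by
    have heq : ∀ t v u, pev (ct v u) t =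
        ∑ a : Fin (D + 1), ∑ b : Fin (D + 1), H a b u * t ^ (a : ℕ) * v ^ (b : ℕ) := by
      intro t v u
      simp only [pev, hct, Finset.sum_mul]
      exact Finset.sum_congr rfl fun a _ => Finset.sum_congr rfl fun b _ => by ring
    simp_rw [heq]; exact hfin
  have h1 := split_t_lt_top W hW ct hctm K hK δt measurableSet_Ioo measurableSet_Ioo hmonot hfin' a
  -- split in `v` with coefficients `H a b u t^a`
  set cv : ℝ → ℝ → Fin (D + 1) → ℝ := fun t u b => H a b u * t ^ (a : ℕ) with hcv
  have hcvm : ∀ b, Measurable fun p : ℝ × ℝ => cv p.1 p.2 b := fun b => by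
    simp only [hcv]
    exact ((hHm a b).comp measurable_snd).mul (measurable_fst.pow_const _)
  have h1' : ∫⁻ t in Ioo 0 δt, ∫⁻ v in Ioo 0 (4 * δ), ∫⁻ u in Ioo 0 (4 * ε),
      ENNReal.ofReal |pev (cv t u) v| * W t v u < ∞ := by
    have heq : ∀ t ∈ Ioo (0 : ℝ) δt, ∀ v u, ENNReal.ofReal |pev (cv t u) v| =
        ENNReal.ofReal (|ct v u a| * t ^ (a : ℕ)) := by
      intro t ht v u
      congr 1
      have : pev (cv t u) v = ct v u a * t ^ (a : ℕ) := by
        simp only [pev, hcv, hct, Finset.sum_mul]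
        exact Finset.sum_congr rfl fun b _ => by ring
      rw [this, abs_mul, abs_of_nonneg (pow_nonneg ht.1.le _)]
    calc ∫⁻ t in Ioo 0 δt, ∫⁻ v in Ioo 0 (4 * δ), ∫⁻ u in Ioo 0 (4 * ε),
          ENNReal.ofReal |pev (cv t u) v| * W t v u
        = ∫⁻ t in Ioo 0 δt, ∫⁻ v in Ioo 0 (4 * δ), ∫⁻ u in Ioo 0 (4 * ε),
          ENNReal.ofReal (|ct v u a| * t ^ (a : ℕ)) * W t v u :=
          setLIntegral_congr_fun measurableSet_Ioo fun t ht => by simp only [heq t ht]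
      _ < ∞ := h1
  have h2 := split_v_lt_top W hW cv hcvm K hK δ measurableSet_Ioo measurableSet_Ioo hmonov h1' b
  -- lower bound in `u` on the dyadic range, then sweep
  have h3 : ∫⁻ t in Ioo 0 δt, ∫⁻ v in Ioo 0 δ, ∫⁻ u in Ioo (2 * ε) (4 * ε),
      ENNReal.ofReal (t ^ (a : ℕ) * v ^ (b : ℕ)) * W t v u < ∞ := by
    refine lower_last_lt_top W (C := Ioo 0 (4 * ε)) measurableSet_Ioo measurableSet_Ioo
      measurableSet_Ioo (Ioo_subset_Ioo (by linarith) le_rfl) (H a b)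
      (fun t v => t ^ (a : ℕ) * v ^ (b : ℕ))
      (fun t ht v hv => mul_nonneg (pow_nonneg ht.1.le _) (pow_nonneg hv.1.le _)) hh
      (fun u hu => hle u (Ioo_subset_Icc_self hu)) ?_
    calc ∫⁻ t in Ioo 0 δt, ∫⁻ v in Ioo 0 δ, ∫⁻ u in Ioo 0 (4 * ε),
          ENNReal.ofReal (|H a b u| * (t ^ (a : ℕ) * v ^ (b : ℕ))) * W t v u
        = ∫⁻ t in Ioo 0 δt, ∫⁻ v in Ioo 0 δ, ∫⁻ u in Ioo 0 (4 * ε),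
          ENNReal.ofReal (|cv t u b| * v ^ (b : ℕ)) * W t v u :=
          setLIntegral_congr_fun measurableSet_Ioo fun t ht => by
            refine lintegral_congr fun v => lintegral_congr fun u => ?_
            congr 2
            simp only [hcv]
            rw [abs_mul, abs_of_nonneg (pow_nonneg ht.1.le _)]
            ring
      _ < ∞ := h2
  have h3' : ∫⁻ t in Ioo 0 δt, ∫⁻ v in Ioo 0 δ, ∫⁻ u in Ioo (4 * ε / 2) (4 * ε),
      ENNReal.ofReal (t ^ (a : ℕ) * v ^ (b : ℕ)) * W t v u < ∞ := by
    rwa [show 4 * ε / 2 = 2 * ε by ring]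
  exact sweep_u_lt_top W hW Kn C hC (by linarith) measurableSet_Ioo measurableSet_Ioo hulog
    (fun t v => t ^ (a : ℕ) * v ^ (b : ℕ)) h3'

/-! ### Finite sums of pieces -/

/-- Iterated set integrals of finite sums (three variables). -/
theorem lintegral₃_finset_sum {ι : Type*} (T : Finset ι) (f : ι → ℝ → ℝ → ℝ → ℝ≥0∞)
    (hf : ∀ s ∈ T, Measurable fun p : ℝ × ℝ × ℝ => f s p.1 p.2.1 p.2.2) (A B C : Set ℝ) :
    ∫⁻ t in A, ∫⁻ v in B, ∫⁻ u in C, ∑ s ∈ T, f s t v u =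
      ∑ s ∈ T, ∫⁻ t in A, ∫⁻ v in B, ∫⁻ u in C, f s t v u := by
  have h1 : ∀ t v, ∫⁻ u in C, ∑ s ∈ T, f s t v u = ∑ s ∈ T, ∫⁻ u in C, f s t v u := fun t v =>
    lintegral_finsetSum' T fun s hs => (measurable_secU (f s) (hf s hs) t v).aemeasurable
  have h2 : ∀ t, ∫⁻ v in B, ∑ s ∈ T, ∫⁻ u in C, f s t v u = ∑ s ∈ T, ∫⁻ v in B, ∫⁻ u in C, f s t v u :=
    fun t => lintegral_finsetSum' T fun s hs =>
      ((measurable_secVU (f s) (hf s hs) t).lintegral_prod_right').aemeasurable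
  simp_rw [h1, h2]
  exact lintegral_finsetSum' T fun s hs =>
    ((measurable_intU (f s) (hf s hs) C).lintegral_prod_right').aemeasurable

/-- **Pieces of a bigraded sum.** If every row `(a, b)` of a piece is either identically zero
or has `t^a v^b · W` integrable, and the rows are bounded, the piece is absolutely integrable. -/
theorem pieces_bigraded_lt_top (hW : Measurable fun p : ℝ × ℝ × ℝ => W p.1 p.2.1 p.2.2)
    (Γ : Fin (D + 1) → Fin (D + 1) → ℝ → ℝ) (hΓm : ∀ a b, Measurable (Γ a b)) {B : ℝ}
    (hB : 0 ≤ B) {A Bv : Set ℝ} (hA : MeasurableSet A) (hBv : MeasurableSet Bv) {η : ℝ}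
    (hA0 : ∀ t ∈ A, 0 ≤ t) (hBv0 : ∀ v ∈ Bv, 0 ≤ v)
    (hΓB : ∀ a b, ∀ u ∈ Ioo (0 : ℝ) η, |Γ a b u| ≤ B)
    (hrows : ∀ a b, (∀ u ∈ Ioo (0 : ℝ) η, Γ a b u = 0) ∨
      ∫⁻ t in A, ∫⁻ v in Bv, ∫⁻ u in Ioo 0 η,
        ENNReal.ofReal (t ^ (a : ℕ) * v ^ (b : ℕ)) * W t v u < ∞) :
    ∫⁻ t in A, ∫⁻ v in Bv, ∫⁻ u in Ioo 0 η, ENNReal.ofReal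
      |∑ a : Fin (D + 1), ∑ b : Fin (D + 1), Γ a b u * t ^ (a : ℕ) * v ^ (b : ℕ)| * W t v u < ∞ := by
  classical
  set T : Finset (Fin (D + 1) × Fin (D + 1)) := Finset.univ with hT
  set f : Fin (D + 1) × Fin (D + 1) → ℝ → ℝ → ℝ → ℝ≥0∞ := fun ab t v u =>
    ENNReal.ofReal (|Γ ab.1 ab.2 u| * (t ^ (ab.1 : ℕ) * v ^ (ab.2 : ℕ))) * W t v u with hf
  have hfm : ∀ ab ∈ T, Measurable fun p : ℝ × ℝ × ℝ => f ab p.1 p.2.1 p.2.2 := fun ab _ => by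
    refine Measurable.mul (ENNReal.measurable_ofReal.comp ?_) hW
    exact ((hΓm ab.1 ab.2).comp (measurable_snd.comp measurable_snd)).abs.mul
      ((measurable_fst.pow_const _).mul ((measurable_fst.comp measurable_snd).pow_const _))
  have hpt : ∀ t ∈ A, ∀ v ∈ Bv, ∀ u ∈ Ioo (0 : ℝ) η, ENNReal.ofReal
      |∑ a : Fin (D + 1), ∑ b : Fin (D + 1), Γ a b u * t ^ (a : ℕ) * v ^ (b : ℕ)| * W t v u ≤
        ∑ ab ∈ T, f ab t v u := by
    intro t ht v hv u _
    rw [hT, ← Finset.sum_mul]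
    refine mul_le_mul_left ?_ _
    rw [← Finset.sum_product' (f := fun a b => Γ a b u * t ^ (a : ℕ) * v ^ (b : ℕ)),
      Finset.univ_product_univ, ← ENNReal.ofReal_sum_of_nonneg (fun ab _ => by
        have := hA0 t ht; have := hBv0 v hv; positivity)]
    refine ENNReal.ofReal_le_ofReal ((Finset.abs_sum_le_sum_abs _ _).trans (le_of_eq ?_))
    refine Finset.sum_congr rfl fun ab _ => ?_
    rw [abs_mul, abs_mul, abs_of_nonneg (pow_nonneg (hA0 t ht) _),
      abs_of_nonneg (pow_nonneg (hBv0 v hv) _), mul_assoc]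
  have hterm : ∀ ab ∈ T, ∫⁻ t in A, ∫⁻ v in Bv, ∫⁻ u in Ioo 0 η, f ab t v u < ∞ := by
    intro ab _
    rcases hrows ab.1 ab.2 with h0 | hfin
    · have h00 : ∀ t v, ∫⁻ u in Ioo 0 η, f ab t v u = 0 := fun t v => by
        rw [setLIntegral_congr_fun measurableSet_Ioo (fun u hu => by
          show f ab t v u = 0
          simp only [hf, h0 u hu, abs_zero, zero_mul, ENNReal.ofReal_zero])]
        exact lintegral_zero
      simp only [h00, lintegral_zero]
      exact ENNReal.zero_lt_top
    · calc ∫⁻ t in A, ∫⁻ v in Bv, ∫⁻ u in Ioo 0 η, f ab t v u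
          ≤ ∫⁻ t in A, ∫⁻ v in Bv, ∫⁻ u in Ioo 0 η,
              ENNReal.ofReal B * (ENNReal.ofReal (t ^ (ab.1 : ℕ) * v ^ (ab.2 : ℕ)) * W t v u) := by
            refine iter_mono hA hBv measurableSet_Ioo fun t ht v hv u hu => ?_
            rw [hf, ← mul_assoc, ← ENNReal.ofReal_mul hB]
            exact mul_le_mul_left (ENNReal.ofReal_le_ofReal (mul_le_mul_of_nonneg_right
              (hΓB ab.1 ab.2 u hu) (by have := hA0 t ht; have := hBv0 v hv; positivity))) _
        _ = ENNReal.ofReal B * ∫⁻ t in A, ∫⁻ v in Bv, ∫⁻ u in Ioo 0 η,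
              ENNReal.ofReal (t ^ (ab.1 : ℕ) * v ^ (ab.2 : ℕ)) * W t v u := by
            rw [← lintegral_const_mul' _ _ ENNReal.ofReal_ne_top]
            refine lintegral_congr fun t => ?_
            rw [← lintegral_const_mul' _ _ ENNReal.ofReal_ne_top]
            refine lintegral_congr fun v => ?_
            rw [← lintegral_const_mul' _ _ ENNReal.ofReal_ne_top]
        _ < ∞ := ENNReal.mul_lt_top ENNReal.ofReal_lt_top hfin
  calc ∫⁻ t in A, ∫⁻ v in Bv, ∫⁻ u in Ioo 0 η, ENNReal.ofReal
        |∑ a : Fin (D + 1), ∑ b : Fin (D + 1), Γ a b u * t ^ (a : ℕ) * v ^ (b : ℕ)| * W t v u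
      ≤ ∫⁻ t in A, ∫⁻ v in Bv, ∫⁻ u in Ioo 0 η, ∑ ab ∈ T, f ab t v u :=
        iter_mono hA hBv measurableSet_Ioo hpt
    _ = ∑ ab ∈ T, ∫⁻ t in A, ∫⁻ v in Bv, ∫⁻ u in Ioo 0 η, f ab t v u :=
        lintegral₃_finset_sum T f hfm _ _ _
    _ < ∞ := ENNReal.sum_lt_top.2 hterm

/-! ### Type (III), monomial frames: disjoint supports -/

/-- The triple polynomial is bounded by the sum of its absolute monomials. -/
theorem abs_pev₃_le (c : Coef₃ D) {t v u : ℝ} (ht : 0 ≤ t) (hv : 0 ≤ v) (hu : 0 ≤ u) :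
    |pev₃ c t v u| ≤ ∑ x : Fin (D + 1) × Fin (D + 1) × Fin (D + 1),
      |c x.1 x.2.1 x.2.2| * (t ^ (x.1 : ℕ) * v ^ (x.2.1 : ℕ) * u ^ (x.2.2 : ℕ)) := by
  have hR : (∑ x : Fin (D + 1) × Fin (D + 1) × Fin (D + 1),
      |c x.1 x.2.1 x.2.2| * (t ^ (x.1 : ℕ) * v ^ (x.2.1 : ℕ) * u ^ (x.2.2 : ℕ))) =
      ∑ i, ∑ j, ∑ l, |c i j l| * (t ^ (i : ℕ) * v ^ (j : ℕ) * u ^ (l : ℕ)) := by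
    rw [Fintype.sum_prod_type]
    refine Finset.sum_congr rfl fun i _ => ?_
    rw [Fintype.sum_prod_type]
  rw [hR]
  unfold pev₃
  refine (Finset.abs_sum_le_sum_abs _ _).trans (Finset.sum_le_sum fun i _ => ?_)
  refine (Finset.abs_sum_le_sum_abs _ _).trans (Finset.sum_le_sum fun j _ => ?_)
  refine (Finset.abs_sum_le_sum_abs _ _).trans (Finset.sum_le_sum fun l _ => le_of_eq ?_)
  rw [abs_mul, abs_mul, abs_mul, abs_of_nonneg (pow_nonneg ht _), abs_of_nonneg (pow_nonneg hv _),
    abs_of_nonneg (pow_nonneg hu _)]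
  ring

/-- **Ray theorem of type (III), monomial frames.** If finitely many coefficient tensors have
pairwise disjoint supports and the polynomial of their sum is absolutely `W`-integrable on the
big box, then the polynomial of each of them is, on the small box. -/
theorem ray_trigraded3 {P : Type*} [Fintype P] (hW : Measurable fun p : ℝ × ℝ × ℝ => W p.1 p.2.1 p.2.2)
    (g : P → Coef₃ D) (K : ℝ≥0∞) (hK : K ≠ ∞) (δt δ ε : ℝ)
    (hmono : ∀ t v u t' v' u', 0 < t → t ≤ t' → t' ≤ 4 * t → t' < 4 * δt → 0 < v → v ≤ v' →
      v' ≤ 4 * v → v' < 4 * δ → 0 < u → u ≤ u' → u' ≤ 4 * u → u' < 4 * ε →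
      W t v u ≤ K * W t' v' u')
    (hdisj : ∀ a b c p p', g p a b c ≠ 0 → g p' a b c ≠ 0 → p = p')
    (hfin : ∫⁻ t in Ioo 0 (4 * δt), ∫⁻ v in Ioo 0 (4 * δ), ∫⁻ u in Ioo 0 (4 * ε),
      ENNReal.ofReal |pev₃ (∑ p, g p) t v u| * W t v u < ∞) (p : P) :
    ∫⁻ t in Ioo 0 δt, ∫⁻ v in Ioo 0 δ, ∫⁻ u in Ioo 0 ε,
      ENNReal.ofReal |pev₃ (g p) t v u| * W t v u < ∞ := by
  classical
  have hsplit := monoSplit₃ (∑ p, g p) W hW K hK δt δ ε hmono hfin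
  -- the coefficient of the sum at a monomial of the piece is the coefficient of the piece
  have hcoef : ∀ a b c, g p a b c ≠ 0 → (∑ p', g p') a b c = g p a b c := by
    intro a b c hg
    rw [Finset.sum_apply, Finset.sum_apply, Finset.sum_apply, Finset.sum_eq_single p]
    · intro p' _ hp'
      by_contra h
      exact hp' (hdisj a b c p' p h hg)
    · intro h; exact absurd (Finset.mem_univ p) h
  set T : Finset (Fin (D + 1) × Fin (D + 1) × Fin (D + 1)) := Finset.univ with hT
  set f : Fin (D + 1) × Fin (D + 1) × Fin (D + 1) → ℝ → ℝ → ℝ → ℝ≥0∞ := fun x t v u =>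
    ENNReal.ofReal (|g p x.1 x.2.1 x.2.2| * (t ^ (x.1 : ℕ) * v ^ (x.2.1 : ℕ) * u ^ (x.2.2 : ℕ))) *
      W t v u with hf
  have hfm : ∀ x ∈ T, Measurable fun q : ℝ × ℝ × ℝ => f x q.1 q.2.1 q.2.2 := fun x _ => by
    refine Measurable.mul (ENNReal.measurable_ofReal.comp (measurable_const.mul ?_)) hW
    exact ((measurable_fst.pow_const _).mul ((measurable_fst.comp measurable_snd).pow_const _)).mul
      ((measurable_snd.comp measurable_snd).pow_const _)
  have hpt : ∀ t ∈ Ioo (0 : ℝ) δt, ∀ v ∈ Ioo (0 : ℝ) δ, ∀ u ∈ Ioo (0 : ℝ) ε,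
      ENNReal.ofReal |pev₃ (g p) t v u| * W t v u ≤ ∑ x ∈ T, f x t v u := by
    intro t ht v hv u hu
    rw [hT, ← Finset.sum_mul]
    refine mul_le_mul_left ?_ _
    rw [← ENNReal.ofReal_sum_of_nonneg (fun x _ => by
      have := ht.1.le; have := hv.1.le; have := hu.1.le; positivity)]
    exact ENNReal.ofReal_le_ofReal (abs_pev₃_le (g p) ht.1.le hv.1.le hu.1.le)
  have hterm : ∀ x ∈ T, ∫⁻ t in Ioo 0 δt, ∫⁻ v in Ioo 0 δ, ∫⁻ u in Ioo 0 ε, f x t v u < ∞ := by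
    intro x _
    by_cases hg : g p x.1 x.2.1 x.2.2 = 0
    · have h00 : ∀ t v u, f x t v u = 0 := fun t v u => by
        simp only [hf, hg, abs_zero, zero_mul, ENNReal.ofReal_zero]
      simp only [h00, lintegral_zero]
      exact ENNReal.zero_lt_top
    · have h := hsplit x.1 x.2.1 x.2.2
      rw [hcoef _ _ _ hg] at h
      calc ∫⁻ t in Ioo 0 δt, ∫⁻ v in Ioo 0 δ, ∫⁻ u in Ioo 0 ε, f x t v u
          = ∫⁻ t in Ioo 0 δt, ∫⁻ v in Ioo 0 δ, ∫⁻ u in Ioo 0 ε,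
              ENNReal.ofReal (|g p x.1 x.2.1 x.2.2| * t ^ (x.1 : ℕ) * v ^ (x.2.1 : ℕ) * u ^ (x.2.2 : ℕ)) *
                W t v u := by
            refine lintegral_congr fun t => lintegral_congr fun v => lintegral_congr fun u => ?_
            simp only [hf, mul_assoc]
        _ < ∞ := h
  calc ∫⁻ t in Ioo 0 δt, ∫⁻ v in Ioo 0 δ, ∫⁻ u in Ioo 0 ε, ENNReal.ofReal |pev₃ (g p) t v u| * W t v u
      ≤ ∫⁻ t in Ioo 0 δt, ∫⁻ v in Ioo 0 δ, ∫⁻ u in Ioo 0 ε, ∑ x ∈ T, f x t v u :=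
        iter_mono measurableSet_Ioo measurableSet_Ioo measurableSet_Ioo hpt
    _ = ∑ x ∈ T, ∫⁻ t in Ioo 0 δt, ∫⁻ v in Ioo 0 δ, ∫⁻ u in Ioo 0 ε, f x t v u :=
        lintegral₃_finset_sum T f hfm _ _ _
    _ < ∞ := ENNReal.sum_lt_top.2 hterm

end SepHHK

/-- **Ray theorem of type (I) on a nested thin sector** (registered part of `stub_separateHigh`,
base dimension `3` with fibres; literal form of `SepHHK.ray_order3`): for a jointly measurable
weight that is almost decreasing towards `t → 0` at ratio `4` and has logarithmic contraction
costs in `v` and `u`, if the polynomial `∑ₐ Φₐ(v, u) t^a` is absolutely integrable on the big box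
and the row `Φ_{a₀}` is bounded below by `h > 0` on the dyadic box `[2δ, 4δ] × [2ε, 4ε]`, then
`t^{a₀}` is integrable against the weight over `(0, δt) × (0, 4δ) × (0, 4ε)`. -/
theorem separateThreeHHK_ray (D : ℕ) (W : ℝ → ℝ → ℝ → ENNReal) (hW : Measurable fun p : ℝ × ℝ × ℝ => W p.1 p.2.1 p.2.2) (Φ : Fin (D + 1) → ℝ → ℝ → ℝ) (hΦm : ∀ a, Measurable fun p : ℝ × ℝ => Φ a p.1 p.2) (K : ENNReal) (hK : K ≠ ⊤) (Kn : ℕ) (C : ENNReal) (hC : C ≠ ⊤) (δt δ ε : ℝ) (hδ : 0 < δ) (hε : 0 < ε) (hmono : ∀ v ∈ Set.Ioo (0 : ℝ) (4 * δ), ∀ u ∈ Set.Ioo (0 : ℝ) (4 * ε), ∀ t t' : ℝ, 0 < t → t ≤ t' → t' ≤ 4 * t → t' < 4 * δt → W t v u ≤ K * W t' v u) (hvlog : ∀ t ∈ Set.Ioo (0 : ℝ) δt, ∀ u ∈ Set.Ioo (0 : ℝ) (4 * ε), ∀ v v' : ℝ, 0 < v → v ≤ v' → v' < 4 * δ → W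 t v u ≤ C * ENNReal.ofReal ((1 + Real.log (v' / v)) ^ Kn) * W t v' u) (hulog : ∀ t ∈ Set.Ioo (0 : ℝ) δt, ∀ v ∈ Set.Ioo (2 * δ) (4 * δ), ∀ u u' : ℝ, 0 < u → u ≤ u' → u' < 4 * ε → W t v u ≤ C * ENNReal.ofReal ((1 + Real.log (u' / u)) ^ Kn) * W t v u') (a₀ : Fin (D + 1)) (h : ℝ) (hh : 0 < h) (hlow : ∀ v ∈ Set.Icc (2 * δ) (4 * δ), ∀ u ∈ Set.Icc (2 * ε) (4 * ε), h ≤ |Φ a₀ v u|) (hfin : MeasureTheory.lintegral (MeasureTheory.volume.restrict (Set.Ioo 0 (4 * δt))) (fun t => MeasureTheory.lintegral (MeasureTheory.volume.restrict (Set.Ioo 0 (4 * δ))) (fun v => MeasureTheory.lintegral (MeasureTheory.volume.restrict (Set.Ioo 0 (4 * ε))) (fun u => ENNReal.ofReal |∑ a : Fin (D + 1), Φ a v u * t ^ (a : ℕ)| * W t v u))) < ⊤) : MeasureTheory.lintegral (MeasureTheory.volume.restrict (Set.Ioo 0 δt)) (fun t => MeasureTheory.lintegral (MeasureTheory.volume.restrict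 (Set.Ioo 0 (4 * δ))) (fun v => MeasureTheory.lintegral (MeasureTheory.volume.restrict (Set.Ioo 0 (4 * ε))) (fun u => ENNReal.ofReal (t ^ (a₀ : ℕ)) * W t v u))) < ⊤ := by
  exact SepHHK.ray_order3 W hW Φ hΦm K hK Kn C hC hδ hε hmono hvlog hulog a₀ hh hlow hfin

end Summit.KontsevichZagierPeriods.ArrangementNormalForm.JanusBands
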